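/-
Copyright: lit-balaban Phase-2 proof seat p09 (gen 9).  Statement-level skeleton of a published paper; no proof claims beyond what
the kernel checks below.
-/
import Literature.MathematicalPhysics.QuantumFieldTheory.BalabanImbrieJaffe1984to88.BIJ85LineSumTkKernel
import Literature.MathematicalPhysics.QuantumFieldTheory.BalabanImbrieJaffe1984to88.BIJ88Decay216Native
import Literature.MathematicalPhysics.QuantumFieldTheory.Balaban1983to89.B3TorusRadialSums
import Literature.MathematicalPhysics.QuantumFieldTheory.BalabanImbrieJaffe1984to88.BIJ85Sect72AllToriHolds
import Literature.MathematicalPhysics.QuantumFieldTheory.BalabanImbrieJaffe1984to88.BIJ85Ineq723TorusCE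

/-!
# [BalabanImbrieJaffe1985] §7.3 p. 326: the unit-bond LINE SUMS of the correction `T_kg = 𝒟_k∂*Q^{e*}_kg` FROM THE KERNEL ESTIMATES
(7.2.2)–(7.2.3), scale by scale — p11's located constant `K_T` (`BIJ85Claim73SecondForm.SecClosedIdx.hT`) is at most LINEAR IN `k`
on every two-dimensional torus, hypothesis-free (GAPS G-C1-05 ADDENDUM 7, route (ii))

T. Bałaban, J. Imbrie, A. Jaffe, *Renormalization of the Higgs model: minimizers, propagators and the stability of mean field theory*,
Commun. Math. Phys. **97** (1985) 299–329 [BalabanImbrieJaffe1985].  Rows **C1.Eq7.2.1-7.2.2**, **C1.Eq7.2.3** (the estimates used) and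
**C1.Eq7.3.1-7.3.2** (second printed form of (7.3.2), where the constant is consumed) of the lit-balaban skeleton (owner r15, referee ref-5).

THE PRINTED TEXT, verbatim.  p. 325 [PDF 27]: *"The kernel H_{k,μν}(x,y) and its gradient decay exponentially. … |H_{k,μν}(x,y)| +
|∇H_{k,μν}(x,y)| + … ≦ Me^{−δ|x−y|}. (7.2.2) The unit lattice propagator C^{(k)} also has exponential decay, |C^{(k)}_{μν}(x,y)| ≦ Me^{−δ|x−y|},
(7.2.3)"*; p. 326 [PDF 28]: *"The operators 𝒟_k have the same properties as the operators G_k in [6I], Proposition 1.2 … These properties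
follow from (4.4.4) and the above estimates on H_k, C^{(k)}."*; *"The second form of the inequality substitutes v_b for u_k(b) in the
covariant derivative of φ."*

WHAT THIS FILE PROVES (0 `sorry`, theorems only — proof lane; standing range `k ≤ m + K`; the operators OF RECORD `HkE`, `CE`, `QesOp`,
`curlOp`, `TkF`; p11's `lineSumIter`):
* §1 **`sum_exp_neg_supDist_run_le`** — the line count: along a straight run of `N ≤ |T|` sites, `Σ_{t<N} e^{−r|x₀+te_μ − y|_∞} ≤ 2(1 + r⁻¹)`
  for every `y`, uniformly in the volume (each circular `μ`-distance occurs at most twice; `B3TorusRadialSums.sum_exp_neg_cdist_le`).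
* §2 **`coord_eq_face_sum`** (`u^{(j)}_p(b₂) = (L^k)^{−(d−2)}Σ_{q∈B^e_k(p)}(∂^{L^k}H_je_{b₂})(q)`, p08's `adjoint_HkE_coord` unfolded) and
  **`abs_term_le`** (every `d ≥ 2`): `|Σ_{b₁,b₂} H_j(b,b₁)C^{(j)}(b₁,b₂)u^{(j)}_p(b₂)| ≤ 2M²M_C d²e^{a/2}K(a)²·(L^k/L^j)(L^{k−j})^{d−2}(L^k)^{−(d−2)}·
  Σ_{q∈B^e_k(p)} e^{−a|b₋−q₋|_∞/L^j}`, `a = min(δ,δ_C)/2`, from the sup member of (7.2.2) for `H_j(b,b₁)`, r18's ambient rescaling of (7.2.3)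
  (`abs_inner_cE_ambient_le`), p08's `abs_curl_col_le` for the columns (the gradient member: one factor `L^{−j}`) and p08's `triple_sum_le`.
* §3 **`sum_line_exp_le`**, **`exp_worst_le`**, **`sum_line_plaq_term_le`** (every `d ≥ 2`): summed along the `L^k` bonds
  of the line and over all unit plaquettes, the scale-`j` terms are at most `A_j·2(1 + 2L^j/a)·e^{3a/4}·d²·e^{a/4}(2(1 + 2d/a))^d`,
  `A_j = 2M²M_C(L^{k−j})^{d−2}d²e^{a/2}K(a)²(L^k/L^j)` (half the rate for the line count, half for the worst bond of the line against the
  face of `p`, which lies within `(L^k−1)/2` of the block centre; p08's `supDist_ctr_le_of_mem`, `sum_exp_neg_distEU_le`; `card_edgeBTo`).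
* §4 **`eta_abs_lineSumIter_TkF_le_two`** (`d = 2`): `η·|Σ_{b′⊂c}(T_kg)_{b′}| ≤ K₀·k·max|g|` with `K₀ = K₀(M, M_C, δ, δ_C)` explicit,
  independent of `k`, `L` and the volume, GIVEN the two members of (7.2.2) for every `H_j`, `j < k`, and (7.2.3) for every `C^{(j)}`, `j < k`
  — each scale contributes at most `K₀` (`η(L^k/L^j)·2(1 + 2L^j/a) ≤ 2(1 + 2/a)`); for ALL `g`, closed or not.
* §5 **`exists_KT_linear_allTori`** — HYPOTHESIS-FREE: for every odd `L > 1` ONE `K₀ ≥ 0` for all tori with `d = 2`, `P.L = L`, all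
  `k ≤ m + K`, all `g`, all unit bonds: the all-tori members of (7.2.2) (p16/p19 `BIJ85Sect72AllToriHolds.exists_absH_le_allTori`,
  `exists_gradB_allTori`; scale 0: `abs_H_zero_le`) and the all-tori (7.2.3) (`BIJ85Ineq723TorusCE.ineq723_CE`).
HONEST SCOPE (v1.1: items (i)–(ii) corrected, p09 gen 10 — GAPS G-C1-05 ADDENDUM 7 SUPPLEMENTS 2–3; declarations byte-identical to v1).
(i) `d = 2` only for §§4–5.  In `d ≥ 3` this route FAILS (v1 said "not done" and proposed summing the face column against the kernel — that
does not help): along the unit bond adjacent to an edge column every η-bond `x_t` of the line has an edge plaquette `q_t ∈ B^e_k(p)` at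
sup-distance `1`, and the ambient factor `(L^{k−j})^{d−2}` is EXACT (`BIJ88Decay216Native.inner_cE_ambient_eq`), so the §2 majorant
`abs_term_le` summed along the line (times `η`) has scale-`j` share `≥ C₀e^{−a₀/L^j}L^k(L^j)^{−(d−1)}`, i.e. `≥ C₀e^{−a₀}L^k` at `j = 0`;
any `d ≥ 3` bound must use the SIGNED structure of the column sum `Σ_{q∈B^e_k(p)}(∂^{L^k}H_je_{b₂})(q)` (cancellation).  (ii) The bound is
LINEAR in the number of scales `k`: it instantiates p11's per-`k` structure `SecClosedIdx` with `K_T := K₀·k`.  This is a PARTIAL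
discharge of the typed (k-uniform) slot and a genuine weakening relative to the print, NOT absorbed downstream (v1 claimed
`k ≤ 2log(e_k⁻¹)/log L` — backwards): by (4.2.4) p. 310 `e_k = e(L^kε)^{(4−d)/2}` with `η = L^{−k}` ((2.24)) the coupling GROWS with `k`,
it is `N − k`, not `k`, that is `≤ 2ln(e_k⁻¹)/((4−d)ln L)`, and at the last step `K₀·k = K₀·log_L(ε⁻¹) → ∞`; the k-UNIFORM constant that
the numerics of GAPS G-C1-05 ADDENDUM 7 indicate (per-scale shares decaying geometrically, a cancellation this absolute-value bound
cannot see) is NOT proved and is NECESSARY for the printed use of (7.3.2).  (iii) Constants explicit, far from optimal; `ℓ^∞` torus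
distances; real fields, `U = 1`, torus, standing range.  Nothing printed is contradicted; the typed slot is not altered.

statement-level skeleton of published theorems with citation tags; proofs where landed; nothing here is a claim about the Yang–Mills mass gap
-/

open scoped BigOperators RealInnerProductSpace
open Finset

namespace Literature.MathematicalPhysics.QuantumFieldTheory.BalabanImbrieJaffe1984to88.BIJ85LineSumTkBound

open Balaban1983to89 hiding Site Plaq
open Balaban1983to89.LatticeFieldCalculus hiding runSite runBond runSite_zero
open Balaban1983to89.B3TorusRadialSums (cdist cdist_le_supDist sum_exp_neg_cdist_le)
open BIJ85AxialPropagator411 (BondSpace toE curlOp)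
open BIJ85Prop521Torus (CoarseSpace toEj)
open BIJ85Prop522Torus (HkE CE DkE)
open BIJ85Sigma421Torus (UnitPlaqSpace toU QesOp)
open BIJ85Sigma422Eta (eta_pos eta_inv)
open BIJ85CellAverages (Cells)
open BIJ85Eq224Base0 (torusEdgeCellsTo)
open BIJ85BlockAveragesTorus (runSite runBond)
open BIJ85BlockAveragesTorusK (cornerIter)
open BIJ85Ineq732SecondForm (lineSumIter)
open BIJ88Eq541Base0 (TkF)
open BIJ85LineSumTkKernel (lineSumIter_TkF_eq)
open BIJ85Sect7Statements BIJ85Ineq722Torus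
open BIJ85Ineq722DeltaA (deltaAData)
open BIJ88Ineq217Ineq722Torus (ofLp_HkE_single)
open BIJ88SigmaKernelDkTorus (adjoint_HkE_coord)
open BIJ88Decay216Torus (abs_curl_col_le triple_sum_le supDist_ctr_le_of_mem sum_exp_neg_distEU_le)
open BIJ88Decay216Native (abs_inner_cE_ambient_le)
open BIJ85Sect72AllToriHolds (exists_absH_le_allTori exists_gradB_allTori)
open BIJ85Sect72AllTori (abs_H_zero_le)
open BIJ85Ineq723TorusCE (ineq723_CE)
open Balaban1983to89 renaming Site → TSite, Plaq → TPlaq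

noncomputable section

variable {P : Params}

/-! ## §1  The line count: each circular coordinate distance is taken at most twice along a straight run -/

/-- kernel: the `μ`-coordinate of the run. [cite: BalabanImbrieJaffe1985, (2.10) p.303] -/
theorem runSite_apply_self {j : ℕ} (x : TSite P j) (μ : Fin P.d) (t : ℕ) : runSite x μ t μ = x μ + t := by
  simp [runSite]

/-- **the line count**: along a straight run of `N ≤ |T|` sites, `Σ_{t<N} e^{−r·|x₀+te_μ − y|_∞} ≤ 2(1 + r⁻¹)` for every site `y`, uniformly
in the volume (the circular `μ`-distances `x₀_μ + t − y_μ` are pairwise distinct residues). [cite: BalabanImbrieJaffe1985, (7.2.2) p.325] -/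
theorem sum_exp_neg_supDist_run_le {j : ℕ} (x₀ y : TSite P j) (μ : Fin P.d) {N : ℕ} (hN : N ≤ P.sitesPerDir j) {r : ℝ}
    (hr : 0 < r) :
    ∑ t ∈ range N, Real.exp (-(r * (supDist (runSite x₀ μ t) y : ℝ))) ≤ 2 * (1 + r⁻¹) := by
  classical
  have h1 : ∀ t, Real.exp (-(r * (supDist (runSite x₀ μ t) y : ℝ))) ≤
      Real.exp (-(r * (cdist (x₀ μ + (t : ZMod (P.sitesPerDir j)) - y μ) : ℝ))) := by
    intro t
    apply Real.exp_le_exp.2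
    have h := cdist_le_supDist (runSite x₀ μ t) y μ
    rw [runSite_apply_self] at h
    have h' : (cdist (x₀ μ + (t : ZMod (P.sitesPerDir j)) - y μ) : ℝ) ≤ (supDist (runSite x₀ μ t) y : ℝ) := by exact_mod_cast h
    nlinarith
  refine (Finset.sum_le_sum fun t _ => h1 t).trans ?_
  set φ : ℕ → ZMod (P.sitesPerDir j) := fun t => x₀ μ + (t : ZMod (P.sitesPerDir j)) - y μ with hφ
  have hinj : Set.InjOn φ (range N : Finset ℕ) := by
    intro t ht t' ht' h
    have ht : t < P.sitesPerDir j := lt_of_lt_of_le (Finset.mem_range.1 ht) hN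
    have ht' : t' < P.sitesPerDir j := lt_of_lt_of_le (Finset.mem_range.1 ht') hN
    have h2 : ((t : ZMod (P.sitesPerDir j))) = (t' : ZMod (P.sitesPerDir j)) := by
      have := h; simp only [hφ] at this; simpa using this
    have h3 := congrArg ZMod.val h2
    rwa [ZMod.val_natCast, ZMod.val_natCast, Nat.mod_eq_of_lt ht, Nat.mod_eq_of_lt ht'] at h3
  have himg : ∑ m ∈ (range N).image φ, Real.exp (-(r * (cdist m : ℝ))) =
      ∑ t ∈ range N, Real.exp (-(r * (cdist (φ t) : ℝ))) := Finset.sum_image hinj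
  calc ∑ t ∈ range N, Real.exp (-(r * (cdist (x₀ μ + (t : ZMod (P.sitesPerDir j)) - y μ) : ℝ)))
      = ∑ m ∈ (range N).image φ, Real.exp (-(r * (cdist m : ℝ))) := himg.symm
    _ ≤ ∑ m : ZMod (P.sitesPerDir j), Real.exp (-(r * (cdist m : ℝ))) :=
        Finset.sum_le_sum_of_subset_of_nonneg (Finset.subset_univ _) fun _ _ _ => (Real.exp_pos _).le
    _ ≤ 2 * (1 + r⁻¹) := sum_exp_neg_cdist_le hr

/-! ## §2  The scale-`j` term at an η-bond `b` against a unit plaquette `p` -/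

/-- kernel: `Σ_b f(b₋) = d·Σ_y f(y)` on `T^{(j)}`. [folklore] -/
private theorem sum_bond_src {j : ℕ} (f : TSite P j → ℝ) : ∑ b : PBond P j, f b.src = (P.d : ℝ) * ∑ y : TSite P j, f y := by
  rw [← Fintype.sum_equiv (LatticeFieldCalculus.bondEquiv (P := P) (j := j)) (fun q : TSite P j × Fin P.d => f q.1) _
    (fun q => rfl), Fintype.sum_prod_type]
  simp only [Finset.sum_const, Finset.card_univ, Fintype.card_fin, nsmul_eq_mul]
  rw [Finset.mul_sum]

/-- kernel: `0 < L^n`. [folklore] -/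
private theorem cast_pow_L_pos' (n : ℕ) : (0 : ℝ) < (P.L : ℝ) ^ n := pow_pos P.cast_L_pos n

/-- kernel: `η_k^d·(η_k⁻¹)^d = 1`. [folklore] -/
private theorem eta_pow_mul_inv_pow (k : ℕ) : (P.eta k) ^ P.d * ((P.eta k)⁻¹) ^ P.d = 1 := by
  rw [← mul_pow, mul_inv_cancel₀ (eta_pos P k).ne', one_pow]

/-- **THE COORDINATES `u^{(j)}_p(b₂)` AS A FACE SUM** (weights `w = η_k^d`, `c = L^k = η_k⁻¹`): `u^{(j)}_p(b₂) = (L^k)^{−(d−2)}·Σ_{q∈B^e_k(p)}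
(∂^{L^k}H_je_{b₂})(q)` — p08's `adjoint_HkE_coord` with the edge average (2.21) unfolded. [cite: BalabanImbrieJaffe1985, (2.21) p.305] -/
theorem coord_eq_face_sum (hd : 2 ≤ P.d) {k : ℕ} (hk : k ≤ P.m + P.K) (j : ℕ) (p : TPlaq P k) (b₂ : PBond P j) :
    LinearMap.adjoint (HkE P ((P.eta k) ^ P.d) ((P.L : ℝ) ^ k) j)
        (LinearMap.adjoint (curlOp (P := P) ((P.eta k) ^ P.d) ((P.L : ℝ) ^ k))
          (QesOp (P := P) hd ((P.eta k) ^ P.d) k (toU P k (Pi.single p 1)))) b₂ =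
      (((P.L : ℝ) ^ k) ^ (P.d - 2))⁻¹ *
        ∑ q ∈ (torusEdgeCellsTo P 0 k k (Nat.zero_add k) hd).B p,
          curl ((P.L : ℝ) ^ k) (WithLp.ofLp (HkE P ((P.eta k) ^ P.d) ((P.L : ℝ) ^ k) j (toEj P j (Pi.single b₂ 1)))) q := by
  rw [adjoint_HkE_coord hd hk (pow_pos (eta_pos P k) _).le ((P.L : ℝ) ^ k) j p b₂, ← eta_inv P k,
    eta_pow_mul_inv_pow, one_mul, eta_inv P k]
  unfold Cells.Q
  simp only [torusEdgeCellsTo, Nat.cast_pow]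

/-- **THE SCALE-`j` TERM AT A BOND AGAINST A UNIT PLAQUETTE** (`j < k ≤ m + K`, every `d ≥ 2`): given the sup member `hH` and the
gradient member `hB` of (7.2.2) for the scale-`j` Landau kernel and (7.2.3) `hC` for the unit-lattice matrix of `C^{(j)}`,
`|Σ_{b₁,b₂} H_j(b,b₁)C^{(j)}(b₁,b₂)u^{(j)}_p(b₂)| ≤ 2M²M_C d²e^{a/2}K(a)² · (L^k/L^j)·(L^{k−j})^{d−2}·(L^k)^{−(d−2)} · Σ_{q∈B^e_k(p)} e^{−a|b₋ − q₋|_∞/L^j}`,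
`a = min(δ, δ_C)/2`: the sup member for `H_j(b, b₁)`, r18's ambient rescaling of (7.2.3) for `C^{(j)}`, p08's `abs_curl_col_le` for the columns
`(∂^{L^k}H_je_{b₂})(q)` (one factor `L^{−j}`), and p08's three-kernel lattice sum `triple_sum_le`, for each face plaquette `q`.
[cite: BalabanImbrieJaffe1985, (7.2.2)–(7.2.3) p.325] -/
theorem abs_term_le (hd : 2 ≤ P.d) {k j : ℕ} (hk : k ≤ P.m + P.K) (hjk : j < k) {a : ℝ} (ha : 0 < a)
    {δ M δC MC : ℝ} (hδ : 0 < δ) (hδC : 0 < δC)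
    (hH : ∀ (μ ν : Fin P.d) (x : TSite P 0) (y : TSite P j),
      |(torusRep P j (deltaAData (by omega : j ≤ P.m + P.K) a)).H (x, μ) (y, ν)| ≤ M * Real.exp (-(δ * distEU P j x y)))
    (hB : ∀ (μ ν : Fin P.d) (x : TSite P 0) (y : TSite P j),
      ‖fun lam : Fin P.d => (P.L : ℝ) ^ j *
          ((torusRep P j (deltaAData (by omega : j ≤ P.m + P.K) a)).H (x.shift lam, μ) (y, ν) -
            (torusRep P j (deltaAData (by omega : j ≤ P.m + P.K) a)).H (x, μ) (y, ν))‖ ≤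
        M * Real.exp (-(δ * distEU P j x y)))
    (hC : ∀ b₁ b₂ : PBond P j, |⟪toEj P j (Pi.single b₁ 1),
      CE P ((P.eta j) ^ P.d) ((P.L : ℝ) ^ j) j (toEj P j (Pi.single b₂ 1))⟫| ≤ MC * Real.exp (-(δC * (supDist b₁.src b₂.src : ℝ))))
    (b : PBond P 0) (p : TPlaq P k) :
    |∑ b₁ : PBond P j, ∑ b₂ : PBond P j,
        HkE P ((P.eta k) ^ P.d) ((P.L : ℝ) ^ k) j (toEj P j (Pi.single b₁ 1)) b *
          ⟪toEj P j (Pi.single b₁ 1), CE P ((P.eta k) ^ P.d) ((P.L : ℝ) ^ k) j (toEj P j (Pi.single b₂ 1))⟫ *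
          LinearMap.adjoint (HkE P ((P.eta k) ^ P.d) ((P.L : ℝ) ^ k) j)
            (LinearMap.adjoint (curlOp (P := P) ((P.eta k) ^ P.d) ((P.L : ℝ) ^ k))
              (QesOp (P := P) hd ((P.eta k) ^ P.d) k (toU P k (Pi.single p 1)))) b₂| ≤
      2 * M ^ 2 * (MC * ((P.L : ℝ) ^ (k - j)) ^ (P.d - 2)) * (P.d : ℝ) ^ 2 *
        (Real.exp (min δ δC / 2 / 2) * ((2 * (1 + P.d / (min δ δC / 2))) ^ P.d) ^ 2) *
        ((P.L : ℝ) ^ k / (P.L : ℝ) ^ j) * (((P.L : ℝ) ^ k) ^ (P.d - 2))⁻¹ *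
        ∑ q ∈ (torusEdgeCellsTo P 0 k k (Nat.zero_add k) hd).B p,
          Real.exp (-(min δ δC / 2 * ((supDist b.src q.src : ℝ) / (P.L : ℝ) ^ j))) := by
  have hj : j ≤ P.m + P.K := by omega
  have hw : 0 < (P.eta k) ^ P.d := pow_pos (eta_pos P k) _
  have hc : (P.L : ℝ) ^ k ≠ 0 := (cast_pow_L_pos' k).ne'
  have hLj : 0 < (P.L : ℝ) ^ j := cast_pow_L_pos' j
  have hM : 0 ≤ M := by
    have h := hH ⟨0, P.hd⟩ ⟨0, P.hd⟩ default default
    exact (mul_nonneg_iff_of_pos_right (Real.exp_pos _)).1 ((abs_nonneg _).trans h)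
  have hMC : 0 ≤ MC := by
    have h := hC ⟨default, ⟨0, P.hd⟩⟩ ⟨default, ⟨0, P.hd⟩⟩
    exact (mul_nonneg_iff_of_pos_right (Real.exp_pos _)).1 ((abs_nonneg _).trans h)
  set G := torusEdgeCellsTo P 0 k k (Nat.zero_add k) hd with hG
  set κ : ℝ := (((P.L : ℝ) ^ k) ^ (P.d - 2))⁻¹ with hκ
  have hκ0 : 0 ≤ κ := by rw [hκ]; positivity
  -- the three kernels
  have hH' : ∀ (b₀ : PBond P 0) (b₁ : PBond P j),
      |HkE P ((P.eta k) ^ P.d) ((P.L : ℝ) ^ k) j (toEj P j (Pi.single b₁ 1)) b₀| ≤ M * Real.exp (-(δ * distEU P j b₀.src b₁.src)) := by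
    intro b₀ b₁
    have e : HkE P ((P.eta k) ^ P.d) ((P.L : ℝ) ^ k) j (toEj P j (Pi.single b₁ 1)) b₀ =
        (torusRep P j (deltaAData hj a)).H (b₀.src, b₀.dir) (b₁.src, b₁.dir) := ofLp_HkE_single hj hc hw ha b₁ b₀.src b₀.dir
    rw [e]
    exact hH _ _ _ _
  have hC' := abs_inner_cE_ambient_le hd hjk.le hC
  have hF : ∀ (q : TPlaq P 0) (b₂ : PBond P j),
      |curl ((P.L : ℝ) ^ k) (WithLp.ofLp (HkE P ((P.eta k) ^ P.d) ((P.L : ℝ) ^ k) j (toEj P j (Pi.single b₂ 1)))) q| ≤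
        (P.L : ℝ) ^ k / (P.L : ℝ) ^ j * (2 * M) * Real.exp (-(δ * distEU P j q.src b₂.src)) := by
    intro q b₂
    have h := abs_curl_col_le hj hc hw ha hB ((P.L : ℝ) ^ k) q b₂
    rwa [abs_of_pos (cast_pow_L_pos' k)] at h
  -- rewrite the coordinates as face sums and exchange the sums
  have hrw : (∑ b₁ : PBond P j, ∑ b₂ : PBond P j,
        HkE P ((P.eta k) ^ P.d) ((P.L : ℝ) ^ k) j (toEj P j (Pi.single b₁ 1)) b *
          ⟪toEj P j (Pi.single b₁ 1), CE P ((P.eta k) ^ P.d) ((P.L : ℝ) ^ k) j (toEj P j (Pi.single b₂ 1))⟫ *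
          LinearMap.adjoint (HkE P ((P.eta k) ^ P.d) ((P.L : ℝ) ^ k) j)
            (LinearMap.adjoint (curlOp (P := P) ((P.eta k) ^ P.d) ((P.L : ℝ) ^ k))
              (QesOp (P := P) hd ((P.eta k) ^ P.d) k (toU P k (Pi.single p 1)))) b₂) =
      κ * ∑ q ∈ G.B p, ∑ b₁ : PBond P j, ∑ b₂ : PBond P j,
        HkE P ((P.eta k) ^ P.d) ((P.L : ℝ) ^ k) j (toEj P j (Pi.single b₁ 1)) b *
          ⟪toEj P j (Pi.single b₁ 1), CE P ((P.eta k) ^ P.d) ((P.L : ℝ) ^ k) j (toEj P j (Pi.single b₂ 1))⟫ *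
          curl ((P.L : ℝ) ^ k) (WithLp.ofLp (HkE P ((P.eta k) ^ P.d) ((P.L : ℝ) ^ k) j (toEj P j (Pi.single b₂ 1)))) q := by
    simp_rw [coord_eq_face_sum hd hk j p, Finset.mul_sum]
    rw [Finset.sum_congr rfl (fun b₁ _ => Finset.sum_comm), Finset.sum_comm]
    refine Finset.sum_congr rfl fun q _ => Finset.sum_congr rfl fun b₁ _ => Finset.sum_congr rfl fun b₂ _ => ?_
    ring
  rw [hrw, abs_mul, abs_of_nonneg hκ0]
  -- termwise bound for each face plaquette
  have hpt : ∀ (q : TPlaq P 0) (b₁ b₂ : PBond P j),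
      |HkE P ((P.eta k) ^ P.d) ((P.L : ℝ) ^ k) j (toEj P j (Pi.single b₁ 1)) b *
          ⟪toEj P j (Pi.single b₁ 1), CE P ((P.eta k) ^ P.d) ((P.L : ℝ) ^ k) j (toEj P j (Pi.single b₂ 1))⟫ *
          curl ((P.L : ℝ) ^ k) (WithLp.ofLp (HkE P ((P.eta k) ^ P.d) ((P.L : ℝ) ^ k) j (toEj P j (Pi.single b₂ 1)))) q| ≤
        2 * M ^ 2 * (MC * ((P.L : ℝ) ^ (k - j)) ^ (P.d - 2)) * ((P.L : ℝ) ^ k / (P.L : ℝ) ^ j) *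
          (Real.exp (-(δ * distEU P j b.src b₁.src)) * Real.exp (-(δC * (supDist b₁.src b₂.src : ℝ))) *
            Real.exp (-(δ * distEU P j q.src b₂.src))) := by
    intro q b₁ b₂
    rw [abs_mul, abs_mul]
    have h1 := hH' b b₁
    have h2 := hF q b₂
    have h3 := hC' b₁ b₂
    calc _ ≤ (M * Real.exp (-(δ * distEU P j b.src b₁.src))) *
          (MC * ((P.L : ℝ) ^ (k - j)) ^ (P.d - 2) * Real.exp (-(δC * (supDist b₁.src b₂.src : ℝ)))) *
          ((P.L : ℝ) ^ k / (P.L : ℝ) ^ j * (2 * M) * Real.exp (-(δ * distEU P j q.src b₂.src))) :=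
          mul_le_mul (mul_le_mul h1 h3 (abs_nonneg _) (by positivity)) h2 (abs_nonneg _) (by positivity)
      _ = _ := by ring
  have hq : ∀ q : TPlaq P 0,
      |∑ b₁ : PBond P j, ∑ b₂ : PBond P j,
          HkE P ((P.eta k) ^ P.d) ((P.L : ℝ) ^ k) j (toEj P j (Pi.single b₁ 1)) b *
            ⟪toEj P j (Pi.single b₁ 1), CE P ((P.eta k) ^ P.d) ((P.L : ℝ) ^ k) j (toEj P j (Pi.single b₂ 1))⟫ *
            curl ((P.L : ℝ) ^ k) (WithLp.ofLp (HkE P ((P.eta k) ^ P.d) ((P.L : ℝ) ^ k) j (toEj P j (Pi.single b₂ 1)))) q| ≤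
        2 * M ^ 2 * (MC * ((P.L : ℝ) ^ (k - j)) ^ (P.d - 2)) * (P.d : ℝ) ^ 2 *
          (Real.exp (min δ δC / 2 / 2) * ((2 * (1 + P.d / (min δ δC / 2))) ^ P.d) ^ 2) *
          ((P.L : ℝ) ^ k / (P.L : ℝ) ^ j) * Real.exp (-(min δ δC / 2 * ((supDist b.src q.src : ℝ) / (P.L : ℝ) ^ j))) := by
    intro q
    calc _ ≤ ∑ b₁ : PBond P j, ∑ b₂ : PBond P j, 2 * M ^ 2 * (MC * ((P.L : ℝ) ^ (k - j)) ^ (P.d - 2)) *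
            ((P.L : ℝ) ^ k / (P.L : ℝ) ^ j) * (Real.exp (-(δ * distEU P j b.src b₁.src)) *
              Real.exp (-(δC * (supDist b₁.src b₂.src : ℝ))) * Real.exp (-(δ * distEU P j q.src b₂.src))) :=
          (Finset.abs_sum_le_sum_abs _ _).trans (Finset.sum_le_sum fun b₁ _ =>
            (Finset.abs_sum_le_sum_abs _ _).trans (Finset.sum_le_sum fun b₂ _ => hpt q b₁ b₂))
      _ = 2 * M ^ 2 * (MC * ((P.L : ℝ) ^ (k - j)) ^ (P.d - 2)) * ((P.L : ℝ) ^ k / (P.L : ℝ) ^ j) *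
            ((P.d : ℝ) * ∑ y : TSite P j, (P.d : ℝ) * ∑ y' : TSite P j, Real.exp (-(δ * distEU P j b.src y)) *
              Real.exp (-(δC * (supDist y y' : ℝ))) * Real.exp (-(δ * distEU P j q.src y'))) := by
          rw [← sum_bond_src (fun y => (P.d : ℝ) * ∑ y' : TSite P j, Real.exp (-(δ * distEU P j b.src y)) *
            Real.exp (-(δC * (supDist y y' : ℝ))) * Real.exp (-(δ * distEU P j q.src y'))), Finset.mul_sum]
          refine Finset.sum_congr rfl fun b₁ _ => ?_
          rw [← sum_bond_src (fun y' => Real.exp (-(δ * distEU P j b.src b₁.src)) * Real.exp (-(δC * (supDist b₁.src y' : ℝ))) *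
            Real.exp (-(δ * distEU P j q.src y'))), Finset.mul_sum]
      _ = 2 * M ^ 2 * (MC * ((P.L : ℝ) ^ (k - j)) ^ (P.d - 2)) * ((P.L : ℝ) ^ k / (P.L : ℝ) ^ j) * (P.d : ℝ) ^ 2 *
            ∑ y : TSite P j, ∑ y' : TSite P j, Real.exp (-(δ * distEU P j b.src y)) *
              Real.exp (-(δC * (supDist y y' : ℝ))) * Real.exp (-(δ * distEU P j q.src y')) := by
          rw [← Finset.mul_sum]; ring
      _ ≤ 2 * M ^ 2 * (MC * ((P.L : ℝ) ^ (k - j)) ^ (P.d - 2)) * ((P.L : ℝ) ^ k / (P.L : ℝ) ^ j) * (P.d : ℝ) ^ 2 *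
            (Real.exp (min δ δC / 2 / 2) * ((2 * (1 + P.d / (min δ δC / 2))) ^ P.d) ^ 2 *
              Real.exp (-(min δ δC / 2 * ((supDist b.src q.src : ℝ) / (P.L : ℝ) ^ j)))) :=
          mul_le_mul_of_nonneg_left (triple_sum_le hj hδ hδC b.src q.src) (by positivity)
      _ = _ := by ring
  calc κ * |∑ q ∈ G.B p, ∑ b₁ : PBond P j, ∑ b₂ : PBond P j,
        HkE P ((P.eta k) ^ P.d) ((P.L : ℝ) ^ k) j (toEj P j (Pi.single b₁ 1)) b *
          ⟪toEj P j (Pi.single b₁ 1), CE P ((P.eta k) ^ P.d) ((P.L : ℝ) ^ k) j (toEj P j (Pi.single b₂ 1))⟫ *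
          curl ((P.L : ℝ) ^ k) (WithLp.ofLp (HkE P ((P.eta k) ^ P.d) ((P.L : ℝ) ^ k) j (toEj P j (Pi.single b₂ 1)))) q|
      ≤ κ * ∑ q ∈ G.B p, (2 * M ^ 2 * (MC * ((P.L : ℝ) ^ (k - j)) ^ (P.d - 2)) * (P.d : ℝ) ^ 2 *
          (Real.exp (min δ δC / 2 / 2) * ((2 * (1 + P.d / (min δ δC / 2))) ^ P.d) ^ 2) *
          ((P.L : ℝ) ^ k / (P.L : ℝ) ^ j) * Real.exp (-(min δ δC / 2 * ((supDist b.src q.src : ℝ) / (P.L : ℝ) ^ j)))) :=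
        mul_le_mul_of_nonneg_left ((Finset.abs_sum_le_sum_abs _ _).trans (Finset.sum_le_sum fun q _ => hq q)) hκ0
    _ = _ := by rw [← Finset.mul_sum]; ring

/-! ## §3  The line sum of the correction, `d = 2`: each scale contributes `O(1)` -/

/-- kernel: the two `runSite`s of the tree (LatticeFieldCalculus / BlockAveragesTorus) agree. [folklore] -/
private theorem supDist_runSite_le' {j : ℕ} (x : TSite P j) (ν : Fin P.d) (i : ℕ) : supDist x (runSite x ν i) ≤ i :=
  supDist_runSite_le x ν i

/-- **along the line, against one face plaquette**: for `j ≤ k`, `L^k ≤ |T^{(0)}|` per direction and every fine plaquette `q`,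
`Σ_{t<L^k} e^{−a|x₀+te_μ − q₋|_∞/L^j} ≤ 2(1 + 2L^j/a)·e^{−(a/2)·max(|x₀ − q₋|_∞ − (L^k−1), 0)/L^k}` — the line count for one half of the
rate, the worst bond of the line for the other half. [cite: BalabanImbrieJaffe1985, (7.2.2) p.325] -/
theorem sum_line_exp_le {j k : ℕ} (hjk : j ≤ k) (hk : P.L ^ k ≤ P.sitesPerDir 0) {a : ℝ} (ha : 0 < a) (x₀ : TSite P 0)
    (μ : Fin P.d) (z : TSite P 0) :
    ∑ t ∈ range (P.L ^ k), Real.exp (-(a * ((supDist (runSite x₀ μ t) z : ℝ) / (P.L : ℝ) ^ j))) ≤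
      2 * (1 + 2 * (P.L : ℝ) ^ j / a) *
        Real.exp (-(a / 2 * (max ((supDist x₀ z : ℝ) - ((P.L : ℝ) ^ k - 1)) 0 / (P.L : ℝ) ^ k))) := by
  have hLj : 0 < (P.L : ℝ) ^ j := cast_pow_L_pos' j
  have hLk : 0 < (P.L : ℝ) ^ k := cast_pow_L_pos' k
  have hLjk : (P.L : ℝ) ^ j ≤ (P.L : ℝ) ^ k := pow_le_pow_right₀ (by exact_mod_cast P.L_pos) hjk
  set E : ℝ := Real.exp (-(a / 2 * (max ((supDist x₀ z : ℝ) - ((P.L : ℝ) ^ k - 1)) 0 / (P.L : ℝ) ^ k))) with hE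
  -- termwise split of the rate
  have hpt : ∀ t ∈ range (P.L ^ k), Real.exp (-(a * ((supDist (runSite x₀ μ t) z : ℝ) / (P.L : ℝ) ^ j))) ≤
      Real.exp (-(a / 2 / (P.L : ℝ) ^ j * (supDist (runSite x₀ μ t) z : ℝ))) * E := by
    intro t ht
    have ht' : (t : ℝ) ≤ (P.L : ℝ) ^ k - 1 := by
      have h := Finset.mem_range.1 ht
      have h' : t + 1 ≤ P.L ^ k := h
      have h'' : ((t + 1 : ℕ) : ℝ) ≤ ((P.L ^ k : ℕ) : ℝ) := by exact_mod_cast h'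
      push_cast at h''
      linarith
    -- |x_t − z| ≥ |x₀ − z| − t
    have htri : (supDist x₀ z : ℝ) ≤ (supDist x₀ (runSite x₀ μ t) : ℝ) + (supDist (runSite x₀ μ t) z : ℝ) := by
      exact_mod_cast supDist_triangle x₀ (runSite x₀ μ t) z
    have hrun : (supDist x₀ (runSite x₀ μ t) : ℝ) ≤ t := by exact_mod_cast supDist_runSite_le' x₀ μ t
    have hdt : max ((supDist x₀ z : ℝ) - ((P.L : ℝ) ^ k - 1)) 0 ≤ (supDist (runSite x₀ μ t) z : ℝ) :=
      max_le (by linarith) (Nat.cast_nonneg _)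
    have hmax0 : 0 ≤ max ((supDist x₀ z : ℝ) - ((P.L : ℝ) ^ k - 1)) 0 := le_max_right _ _
    have hfrac : max ((supDist x₀ z : ℝ) - ((P.L : ℝ) ^ k - 1)) 0 / (P.L : ℝ) ^ k ≤
        (supDist (runSite x₀ μ t) z : ℝ) / (P.L : ℝ) ^ j :=
      calc max ((supDist x₀ z : ℝ) - ((P.L : ℝ) ^ k - 1)) 0 / (P.L : ℝ) ^ k
          ≤ max ((supDist x₀ z : ℝ) - ((P.L : ℝ) ^ k - 1)) 0 / (P.L : ℝ) ^ j :=
            div_le_div_of_nonneg_left hmax0 hLj hLjk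
        _ ≤ (supDist (runSite x₀ μ t) z : ℝ) / (P.L : ℝ) ^ j := div_le_div_of_nonneg_right hdt hLj.le
    have hkey : a / 2 * (max ((supDist x₀ z : ℝ) - ((P.L : ℝ) ^ k - 1)) 0 / (P.L : ℝ) ^ k) ≤
        a / 2 / (P.L : ℝ) ^ j * (supDist (runSite x₀ μ t) z : ℝ) :=
      calc a / 2 * (max ((supDist x₀ z : ℝ) - ((P.L : ℝ) ^ k - 1)) 0 / (P.L : ℝ) ^ k)
          ≤ a / 2 * ((supDist (runSite x₀ μ t) z : ℝ) / (P.L : ℝ) ^ j) := mul_le_mul_of_nonneg_left hfrac (by positivity)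
        _ = a / 2 / (P.L : ℝ) ^ j * (supDist (runSite x₀ μ t) z : ℝ) := by ring
    rw [hE, ← Real.exp_add]
    apply Real.exp_le_exp.2
    have : a * ((supDist (runSite x₀ μ t) z : ℝ) / (P.L : ℝ) ^ j) =
        a / 2 / (P.L : ℝ) ^ j * (supDist (runSite x₀ μ t) z : ℝ) + a / 2 / (P.L : ℝ) ^ j * (supDist (runSite x₀ μ t) z : ℝ) := by
      ring
    rw [this]
    linarith
  calc ∑ t ∈ range (P.L ^ k), Real.exp (-(a * ((supDist (runSite x₀ μ t) z : ℝ) / (P.L : ℝ) ^ j)))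
      ≤ ∑ t ∈ range (P.L ^ k), Real.exp (-(a / 2 / (P.L : ℝ) ^ j * (supDist (runSite x₀ μ t) z : ℝ))) * E :=
        Finset.sum_le_sum hpt
    _ = (∑ t ∈ range (P.L ^ k), Real.exp (-(a / 2 / (P.L : ℝ) ^ j * (supDist (runSite x₀ μ t) z : ℝ)))) * E := by
        rw [Finset.sum_mul]
    _ ≤ 2 * (1 + (a / 2 / (P.L : ℝ) ^ j)⁻¹) * E :=
        mul_le_mul_of_nonneg_right (sum_exp_neg_supDist_run_le x₀ z μ hk (by positivity)) (Real.exp_pos _).le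
    _ = 2 * (1 + 2 * (P.L : ℝ) ^ j / a) * E := by
        congr 2
        field_simp

/-- **the worst bond of the line against the face of `p`**: for `q ∈ B^e_k(p)` (`k ≤ m + K`),
`e^{−(a/2)max(|x₀ − q₋|_∞ − (L^k−1), 0)/L^k} ≤ e^{3a/4}·e^{−(a/2)|x₀ − p|}`, `|x₀ − p| = distEU P k x₀ p₋` (the face lies within
`(L^k−1)/2` of the block centre). [cite: BalabanImbrieJaffe1985, (7.2.2) p.325] -/
theorem exp_worst_le (hd : 2 ≤ P.d) {k : ℕ} (hk : k ≤ P.m + P.K) {a : ℝ} (ha : 0 < a) (x₀ : TSite P 0) {p : TPlaq P k}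
    {q : TPlaq P 0} (hq : q ∈ (torusEdgeCellsTo P 0 k k (Nat.zero_add k) hd).B p) :
    Real.exp (-(a / 2 * (max ((supDist x₀ q.src : ℝ) - ((P.L : ℝ) ^ k - 1)) 0 / (P.L : ℝ) ^ k))) ≤
      Real.exp (3 * a / 4) * Real.exp (-(a / 2 * distEU P k x₀ p.src)) := by
  have hLk : 0 < (P.L : ℝ) ^ k := cast_pow_L_pos' k
  rw [← Real.exp_add]
  apply Real.exp_le_exp.2
  -- |q₋ − ctr p| ≤ (L^k − 1)/2
  have h1 : (supDist q.src (ctr k p.src) : ℝ) ≤ ((P.L : ℝ) ^ k - 1) / 2 := by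
    have h := supDist_ctr_le_of_mem hd hk hq
    have h' : ((supDist q.src (ctr k p.src) : ℕ) : ℝ) ≤ (((P.L ^ k - 1) / 2 : ℕ) : ℝ) := by exact_mod_cast h
    refine h'.trans ?_
    have hL1 : (1 : ℕ) ≤ P.L ^ k := Nat.one_le_pow _ _ P.L_pos
    have h2 : (((P.L ^ k - 1) / 2 : ℕ) : ℝ) ≤ (((P.L ^ k - 1 : ℕ)) : ℝ) / 2 := Nat.cast_div_le
    rw [Nat.cast_sub hL1] at h2
    push_cast at h2
    exact h2
  -- |x₀ − ctr p| ≤ |x₀ − q₋| + |q₋ − ctr p|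
  have h2 : (supDist x₀ (ctr k p.src) : ℝ) ≤ (supDist x₀ q.src : ℝ) + (supDist q.src (ctr k p.src) : ℝ) := by
    exact_mod_cast supDist_triangle x₀ q.src (ctr k p.src)
  have h3 : distEU P k x₀ p.src = (supDist x₀ (ctr k p.src) : ℝ) / (P.L : ℝ) ^ k := rfl
  have hmax : (supDist x₀ q.src : ℝ) - ((P.L : ℝ) ^ k - 1) ≤ max ((supDist x₀ q.src : ℝ) - ((P.L : ℝ) ^ k - 1)) 0 :=
    le_max_left _ _
  -- so max(...)/L^k ≥ distEU − 3/2·(L^k − 1)/L^k ≥ distEU − 3/2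
  have h4 : distEU P k x₀ p.src - 3 / 2 ≤ max ((supDist x₀ q.src : ℝ) - ((P.L : ℝ) ^ k - 1)) 0 / (P.L : ℝ) ^ k := by
    rw [h3, le_div_iff₀ hLk, sub_mul, div_mul_cancel₀ _ hLk.ne']
    have hL1 : (1 : ℝ) ≤ (P.L : ℝ) ^ k := one_le_pow₀ (by exact_mod_cast P.L_pos)
    nlinarith
  nlinarith

/-- kernel: a sum over the unit-lattice plaquettes of a nonnegative function of the base point is at most `d²` times the sum over the
sites (at most `d²` orientations per base point). [folklore] -/
private theorem sum_plaq_src_le {k : ℕ} (f : TSite P k → ℝ) (hf : ∀ y, 0 ≤ f y) :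
    ∑ p : TPlaq P k, f p.src ≤ (P.d : ℝ) ^ 2 * ∑ y : TSite P k, f y := by
  classical
  rw [← Finset.sum_fiberwise_of_maps_to (s := (Finset.univ : Finset (TPlaq P k))) (t := (Finset.univ : Finset (TSite P k)))
    (g := fun p : TPlaq P k => p.src) (fun _ _ => Finset.mem_univ _), Finset.mul_sum]
  refine Finset.sum_le_sum fun y _ => ?_
  have hfib : ∑ p ∈ Finset.univ.filter (fun p : TPlaq P k => p.src = y), f p.src =
      ((Finset.univ.filter (fun p : TPlaq P k => p.src = y)).card : ℝ) * f y := by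
    rw [Finset.sum_congr rfl (fun p hp => by rw [(Finset.mem_filter.1 hp).2]), Finset.sum_const, nsmul_eq_mul]
  rw [hfib]
  refine mul_le_mul_of_nonneg_right ?_ (hf y)
  have hcard : (Finset.univ.filter (fun p : TPlaq P k => p.src = y)).card ≤
      (Finset.univ ×ˢ Finset.univ : Finset (Fin P.d × Fin P.d)).card := by
    refine Finset.card_le_card_of_injOn (fun p => (p.μ, p.ν)) (fun _ _ => Finset.mem_coe.2 (Finset.mem_univ _)) ?_
    intro p hp p' hp' h
    have h1 := (Finset.mem_filter.1 (Finset.mem_coe.1 hp)).2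
    have h2 := (Finset.mem_filter.1 (Finset.mem_coe.1 hp')).2
    obtain ⟨s, μ, ν, hμν⟩ := p
    obtain ⟨s', μ', ν', hμν'⟩ := p'
    simp only [Prod.mk.injEq] at h
    simp only at h1 h2
    subst h1; subst h2
    obtain ⟨rfl, rfl⟩ := h
    rfl
  rw [Finset.card_product, Finset.card_univ, Fintype.card_fin] at hcard
  have : ((Finset.univ.filter (fun p : TPlaq P k => p.src = y)).card : ℝ) ≤ ((P.d * P.d : ℕ) : ℝ) := by exact_mod_cast hcard
  simpa [sq] using this

/-- kernel: there is a unit plaquette (`d ≥ 2`), so a uniform bound `|g| ≤ C` forces `0 ≤ C`. [folklore] -/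
private theorem nonneg_of_bound (hd : 2 ≤ P.d) {k : ℕ} {g : TPlaq P k → ℝ} {C : ℝ} (hg : ∀ q, |g q| ≤ C) : 0 ≤ C :=
  (abs_nonneg _).trans (hg ⟨default, ⟨0, by omega⟩, ⟨1, by omega⟩, by simp [Fin.lt_def]⟩)

/-- **THE SCALE-`j` SHARE OF THE LINE SUM** (every `d ≥ 2`; `j < k ≤ m + K`): summed along the `L^k` bonds of the line from `x₀` and over all
unit plaquettes `p` (weighted by the averaged face factor), the scale-`j` terms are at most
`A_j · 2(1 + 2L^j/a) · e^{3a/4} · d² · e^{a/4}(2(1 + 2d/a))^d`, `A_j = 2M²M_C(L^{k−j})^{d−2}d²e^{a/2}K(a)²·(L^k/L^j)`, `a = min(δ,δ_C)/2`.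
[cite: BalabanImbrieJaffe1985, (7.2.2)–(7.2.3) p.325] -/
theorem sum_line_plaq_term_le (hd : 2 ≤ P.d) {k j : ℕ} (hk : k ≤ P.m + P.K) (hjk : j < k) {a : ℝ} (ha : 0 < a)
    {δ M δC MC : ℝ} (hδ : 0 < δ) (hδC : 0 < δC)
    (hH : ∀ (μ ν : Fin P.d) (x : TSite P 0) (y : TSite P j),
      |(torusRep P j (deltaAData (by omega : j ≤ P.m + P.K) a)).H (x, μ) (y, ν)| ≤ M * Real.exp (-(δ * distEU P j x y)))
    (hB : ∀ (μ ν : Fin P.d) (x : TSite P 0) (y : TSite P j),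
      ‖fun lam : Fin P.d => (P.L : ℝ) ^ j *
          ((torusRep P j (deltaAData (by omega : j ≤ P.m + P.K) a)).H (x.shift lam, μ) (y, ν) -
            (torusRep P j (deltaAData (by omega : j ≤ P.m + P.K) a)).H (x, μ) (y, ν))‖ ≤
        M * Real.exp (-(δ * distEU P j x y)))
    (hC : ∀ b₁ b₂ : PBond P j, |⟪toEj P j (Pi.single b₁ 1),
      CE P ((P.eta j) ^ P.d) ((P.L : ℝ) ^ j) j (toEj P j (Pi.single b₂ 1))⟫| ≤ MC * Real.exp (-(δC * (supDist b₁.src b₂.src : ℝ))))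
    (x₀ : TSite P 0) (μ : Fin P.d) :
    ∑ p : TPlaq P k, ∑ t ∈ range (P.L ^ k),
      |∑ b₁ : PBond P j, ∑ b₂ : PBond P j,
        HkE P ((P.eta k) ^ P.d) ((P.L : ℝ) ^ k) j (toEj P j (Pi.single b₁ 1)) (runBond x₀ μ t) *
          ⟪toEj P j (Pi.single b₁ 1), CE P ((P.eta k) ^ P.d) ((P.L : ℝ) ^ k) j (toEj P j (Pi.single b₂ 1))⟫ *
          LinearMap.adjoint (HkE P ((P.eta k) ^ P.d) ((P.L : ℝ) ^ k) j)
            (LinearMap.adjoint (curlOp (P := P) ((P.eta k) ^ P.d) ((P.L : ℝ) ^ k))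
              (QesOp (P := P) hd ((P.eta k) ^ P.d) k (toU P k (Pi.single p 1)))) b₂| ≤
      (2 * M ^ 2 * (MC * ((P.L : ℝ) ^ (k - j)) ^ (P.d - 2)) * (P.d : ℝ) ^ 2 *
        (Real.exp (min δ δC / 2 / 2) * ((2 * (1 + P.d / (min δ δC / 2))) ^ P.d) ^ 2) *
        ((P.L : ℝ) ^ k / (P.L : ℝ) ^ j)) *
      (2 * (1 + 2 * (P.L : ℝ) ^ j / (min δ δC / 2)) * Real.exp (3 * (min δ δC / 2) / 4) *
        ((P.d : ℝ) ^ 2 * (Real.exp ((min δ δC / 2) / 2 / 2) * (2 * (1 + P.d / ((min δ δC / 2) / 2))) ^ P.d))) := by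
  set a₀ : ℝ := min δ δC / 2 with ha₀
  have ha₀p : 0 < a₀ := by rw [ha₀]; exact half_pos (lt_min hδ hδC)
  set G := torusEdgeCellsTo P 0 k k (Nat.zero_add k) hd with hG
  set κ : ℝ := (((P.L : ℝ) ^ k) ^ (P.d - 2))⁻¹ with hκ
  set A : ℝ := 2 * M ^ 2 * (MC * ((P.L : ℝ) ^ (k - j)) ^ (P.d - 2)) * (P.d : ℝ) ^ 2 *
        (Real.exp (a₀ / 2) * ((2 * (1 + P.d / a₀)) ^ P.d) ^ 2) * ((P.L : ℝ) ^ k / (P.L : ℝ) ^ j) with hA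
  have hLk : 0 < (P.L : ℝ) ^ k := cast_pow_L_pos' k
  have hκ0 : 0 ≤ κ := by rw [hκ]; positivity
  have hM : 0 ≤ M := by
    have h := hH ⟨0, P.hd⟩ ⟨0, P.hd⟩ default default
    exact (mul_nonneg_iff_of_pos_right (Real.exp_pos _)).1 ((abs_nonneg _).trans h)
  have hMC : 0 ≤ MC := by
    have h := hC ⟨default, ⟨0, P.hd⟩⟩ ⟨default, ⟨0, P.hd⟩⟩
    exact (mul_nonneg_iff_of_pos_right (Real.exp_pos _)).1 ((abs_nonneg _).trans h)
  have hA0 : 0 ≤ A := by rw [hA]; positivity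
  have hsites : P.L ^ k ≤ P.sitesPerDir 0 := by
    unfold Params.sitesPerDir
    calc P.L ^ k ≤ P.L ^ (P.m + P.K - 0) := Nat.pow_le_pow_right P.L_pos (by omega)
      _ ≤ 2 * P.L ^ (P.m + P.K - 0) := Nat.le_mul_of_pos_left _ two_pos
  -- per (p, t): the scale-j term bound of §2 at the bond ⟨x₀ + te_μ, μ⟩
  have hterm : ∀ (p : TPlaq P k) (t : ℕ),
      |∑ b₁ : PBond P j, ∑ b₂ : PBond P j,
        HkE P ((P.eta k) ^ P.d) ((P.L : ℝ) ^ k) j (toEj P j (Pi.single b₁ 1)) (runBond x₀ μ t) *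
          ⟪toEj P j (Pi.single b₁ 1), CE P ((P.eta k) ^ P.d) ((P.L : ℝ) ^ k) j (toEj P j (Pi.single b₂ 1))⟫ *
          LinearMap.adjoint (HkE P ((P.eta k) ^ P.d) ((P.L : ℝ) ^ k) j)
            (LinearMap.adjoint (curlOp (P := P) ((P.eta k) ^ P.d) ((P.L : ℝ) ^ k))
              (QesOp (P := P) hd ((P.eta k) ^ P.d) k (toU P k (Pi.single p 1)))) b₂| ≤
        A * κ * ∑ q ∈ G.B p, Real.exp (-(a₀ * ((supDist (runSite x₀ μ t) q.src : ℝ) / (P.L : ℝ) ^ j))) := by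
    intro p t
    have h := abs_term_le hd hk hjk ha hδ hδC hH hB hC (runBond x₀ μ t) p
    simpa only [hA, hκ, hG, ha₀, runBond, mul_assoc] using h
  -- per p: sum along the line, face plaquette by face plaquette
  have hline : ∀ p : TPlaq P k,
      ∑ t ∈ range (P.L ^ k), A * κ * ∑ q ∈ G.B p, Real.exp (-(a₀ * ((supDist (runSite x₀ μ t) q.src : ℝ) / (P.L : ℝ) ^ j))) ≤
        A * (2 * (1 + 2 * (P.L : ℝ) ^ j / a₀) * Real.exp (3 * a₀ / 4) * Real.exp (-(a₀ / 2 * distEU P k x₀ p.src))) := by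
    intro p
    rw [← Finset.mul_sum, Finset.sum_comm]
    have hq : ∀ q ∈ G.B p, ∑ t ∈ range (P.L ^ k), Real.exp (-(a₀ * ((supDist (runSite x₀ μ t) q.src : ℝ) / (P.L : ℝ) ^ j))) ≤
        2 * (1 + 2 * (P.L : ℝ) ^ j / a₀) * Real.exp (3 * a₀ / 4) * Real.exp (-(a₀ / 2 * distEU P k x₀ p.src)) := by
      intro q hq
      calc _ ≤ 2 * (1 + 2 * (P.L : ℝ) ^ j / a₀) *
            Real.exp (-(a₀ / 2 * (max ((supDist x₀ q.src : ℝ) - ((P.L : ℝ) ^ k - 1)) 0 / (P.L : ℝ) ^ k))) :=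
            sum_line_exp_le hjk.le hsites ha₀p x₀ μ q.src
        _ ≤ 2 * (1 + 2 * (P.L : ℝ) ^ j / a₀) * (Real.exp (3 * a₀ / 4) * Real.exp (-(a₀ / 2 * distEU P k x₀ p.src))) :=
            mul_le_mul_of_nonneg_left (exp_worst_le hd hk ha₀p x₀ hq) (by positivity)
        _ = _ := by ring
    have hcardN : (G.B p).card = (P.L ^ k) ^ (P.d - 2) := BIJ85Eq224Base0.card_edgeBTo (Nat.zero_add k) hk hd p
    have hcard : ((G.B p).card : ℝ) = ((P.L : ℝ) ^ k) ^ (P.d - 2) := by rw [hcardN]; push_cast; ring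
    calc A * κ * ∑ q ∈ G.B p, ∑ t ∈ range (P.L ^ k),
          Real.exp (-(a₀ * ((supDist (runSite x₀ μ t) q.src : ℝ) / (P.L : ℝ) ^ j)))
        ≤ A * κ * ∑ q ∈ G.B p, 2 * (1 + 2 * (P.L : ℝ) ^ j / a₀) * Real.exp (3 * a₀ / 4) *
            Real.exp (-(a₀ / 2 * distEU P k x₀ p.src)) :=
          mul_le_mul_of_nonneg_left (Finset.sum_le_sum hq) (mul_nonneg hA0 hκ0)
      _ = A * (κ * (G.B p).card * (2 * (1 + 2 * (P.L : ℝ) ^ j / a₀) * Real.exp (3 * a₀ / 4) *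
            Real.exp (-(a₀ / 2 * distEU P k x₀ p.src)))) := by rw [Finset.sum_const, nsmul_eq_mul]; ring
      _ = _ := by rw [hcard, hκ, inv_mul_cancel₀ (pow_pos hLk _).ne', one_mul]
  -- sum over the unit plaquettes
  have hS := sum_exp_neg_distEU_le hk (half_pos ha₀p) x₀
  calc _ ≤ ∑ p : TPlaq P k, ∑ t ∈ range (P.L ^ k), A * κ *
          ∑ q ∈ G.B p, Real.exp (-(a₀ * ((supDist (runSite x₀ μ t) q.src : ℝ) / (P.L : ℝ) ^ j))) :=
        Finset.sum_le_sum fun p _ => Finset.sum_le_sum fun t _ => hterm p t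
    _ ≤ ∑ p : TPlaq P k, A * (2 * (1 + 2 * (P.L : ℝ) ^ j / a₀) * Real.exp (3 * a₀ / 4) *
          Real.exp (-(a₀ / 2 * distEU P k x₀ p.src))) := Finset.sum_le_sum fun p _ => hline p
    _ = A * (2 * (1 + 2 * (P.L : ℝ) ^ j / a₀) * Real.exp (3 * a₀ / 4)) *
          ∑ p : TPlaq P k, Real.exp (-(a₀ / 2 * distEU P k x₀ p.src)) := by rw [Finset.mul_sum]; refine Finset.sum_congr rfl fun p _ => by ring
    _ ≤ A * (2 * (1 + 2 * (P.L : ℝ) ^ j / a₀) * Real.exp (3 * a₀ / 4)) *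
          ((P.d : ℝ) ^ 2 * ∑ y : TSite P k, Real.exp (-(a₀ / 2 * distEU P k x₀ y))) :=
        mul_le_mul_of_nonneg_left (sum_plaq_src_le (fun y => Real.exp (-(a₀ / 2 * distEU P k x₀ y))) fun _ => (Real.exp_pos _).le)
          (by positivity)
    _ ≤ A * (2 * (1 + 2 * (P.L : ℝ) ^ j / a₀) * Real.exp (3 * a₀ / 4)) *
          ((P.d : ℝ) ^ 2 * (Real.exp (a₀ / 2 / 2) * (2 * (1 + P.d / (a₀ / 2))) ^ P.d)) :=
        mul_le_mul_of_nonneg_left (mul_le_mul_of_nonneg_left hS (by positivity)) (by positivity)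
    _ = _ := by rw [hA]; ring

/-! ## §4  `d = 2`: the line sums of `T_kg` grow at most linearly in `k` -/

/-- **THE LINE SUMS OF THE CORRECTION, `d = 2`, FROM (7.2.2)–(7.2.3)** (`k ≤ m + K`): given the sup and gradient members of (7.2.2) for
every `H_j`, `j < k`, and (7.2.3) for the unit-lattice matrices of `C^{(j)}`, `j < k` (two pairs of constants `(δ, M)`, `(δ_C, M_C)`),
for every unit-lattice plaquette function `g` with `|g| ≤ C` and every unit bond `c`,
`η·|Σ_{b′⊂c}(T_kg)_{b′}| ≤ K₀·k·C`, `K₀ = K₀(M, M_C, δ, δ_C)` explicit and independent of `k`, of `L` and of the volume — each scale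
`j < k` contributes at most `K₀·C` (§3 with `(L^{k−j})^{d−2} = 1` and `η(L^k/L^j)(1 + 2L^j/a) ≤ 1 + 2/a`).  This is the shape of p11's
`SecClosedIdx.hT` with `K_T = K₀·k`, for ALL `g` (closed or not); the `k`-uniform constant suggested by the numerics of GAPS G-C1-05
ADDENDUM 7 is NOT proved here. [cite: BalabanImbrieJaffe1985, (7.3.2) p.326] -/
theorem eta_abs_lineSumIter_TkF_le_two (hd : 2 ≤ P.d) (hd2 : P.d = 2) {k : ℕ} (hk : k ≤ P.m + P.K) {a : ℝ} (ha : 0 < a)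
    {δ M δC MC : ℝ} (hδ : 0 < δ) (hδC : 0 < δC)
    (hH : ∀ (j : ℕ) (hj : j ≤ P.m + P.K), j < k → ∀ (μ ν : Fin P.d) (x : TSite P 0) (y : TSite P j),
      |(torusRep P j (deltaAData hj a)).H (x, μ) (y, ν)| ≤ M * Real.exp (-(δ * distEU P j x y)))
    (hB : ∀ (j : ℕ) (hj : j ≤ P.m + P.K), j < k → ∀ (μ ν : Fin P.d) (x : TSite P 0) (y : TSite P j),
      ‖fun lam : Fin P.d => (P.L : ℝ) ^ j *
          ((torusRep P j (deltaAData hj a)).H (x.shift lam, μ) (y, ν) - (torusRep P j (deltaAData hj a)).H (x, μ) (y, ν))‖ ≤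
        M * Real.exp (-(δ * distEU P j x y)))
    (hC : ∀ j < k, ∀ b₁ b₂ : PBond P j, |⟪toEj P j (Pi.single b₁ 1),
      CE P ((P.eta j) ^ P.d) ((P.L : ℝ) ^ j) j (toEj P j (Pi.single b₂ 1))⟫| ≤ MC * Real.exp (-(δC * (supDist b₁.src b₂.src : ℝ))))
    (g : TPlaq P k → ℝ) {C : ℝ} (hg : ∀ q, |g q| ≤ C) (c : PBond P (0 + k)) :
    P.eta k * |lineSumIter (TkF P hd ((P.eta k) ^ P.d) (P.eta k) k g) k c| ≤
      ((2 * M ^ 2 * MC * (P.d : ℝ) ^ 2 *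
          (Real.exp (min δ δC / 2 / 2) * ((2 * (1 + P.d / (min δ δC / 2))) ^ P.d) ^ 2)) *
        (2 * (1 + 2 / (min δ δC / 2)) * Real.exp (3 * (min δ δC / 2) / 4) *
          ((P.d : ℝ) ^ 2 * (Real.exp ((min δ δC / 2) / 2 / 2) * (2 * (1 + P.d / ((min δ δC / 2) / 2))) ^ P.d)))) *
        k * C := by
  set a₀ : ℝ := min δ δC / 2 with ha₀
  have ha₀p : 0 < a₀ := by rw [ha₀]; exact half_pos (lt_min hδ hδC)
  have hC0 : 0 ≤ C := nonneg_of_bound hd hg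
  have hLk : 0 < (P.L : ℝ) ^ k := cast_pow_L_pos' k
  have hηk : P.eta k = ((P.L : ℝ) ^ k)⁻¹ := by rw [← eta_inv P k, inv_inv]
  -- names for the pieces of the constant
  set K1 : ℝ := Real.exp (a₀ / 2) * ((2 * (1 + P.d / a₀)) ^ P.d) ^ 2 with hK1
  set S' : ℝ := (P.d : ℝ) ^ 2 * (Real.exp (a₀ / 2 / 2) * (2 * (1 + P.d / (a₀ / 2))) ^ P.d) with hS'
  set K₀ : ℝ := (2 * M ^ 2 * MC * (P.d : ℝ) ^ 2 * K1) * (2 * (1 + 2 / a₀) * Real.exp (3 * a₀ / 4) * S') with hK₀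
  -- the case k = 0: no scale, the correction vanishes termwise
  rcases Nat.eq_zero_or_pos k with hk0 | hkpos
  · subst hk0
    rw [lineSumIter_TkF_eq hd hk]
    simp
  have hMC : 0 ≤ MC := by
    have h := hC 0 hkpos ⟨default, ⟨0, P.hd⟩⟩ ⟨default, ⟨0, P.hd⟩⟩
    exact (mul_nonneg_iff_of_pos_right (Real.exp_pos _)).1 ((abs_nonneg _).trans h)
  have hK1p : 0 < K1 := by rw [hK1]; positivity
  have hS'p : 0 < S' := by rw [hS']; positivity
  have hK₀nn : 0 ≤ K₀ := by rw [hK₀]; positivity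
  -- abbreviation for the scale-j term at (t, p)
  set x₀ := cornerIter k c.src with hx₀
  set μ := c.dir with hμ
  let T : ℕ → TPlaq P k → ℕ → ℝ := fun t p j => ∑ b₁ : PBond P j, ∑ b₂ : PBond P j,
    HkE P ((P.eta k) ^ P.d) ((P.L : ℝ) ^ k) j (toEj P j (Pi.single b₁ 1)) (runBond x₀ μ t) *
      ⟪toEj P j (Pi.single b₁ 1), CE P ((P.eta k) ^ P.d) ((P.L : ℝ) ^ k) j (toEj P j (Pi.single b₂ 1))⟫ *
      LinearMap.adjoint (HkE P ((P.eta k) ^ P.d) ((P.L : ℝ) ^ k) j)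
        (LinearMap.adjoint (curlOp (P := P) ((P.eta k) ^ P.d) ((P.L : ℝ) ^ k))
          (QesOp (P := P) hd ((P.eta k) ^ P.d) k (toU P k (Pi.single p 1)))) b₂
  have hrepr : lineSumIter (TkF P hd ((P.eta k) ^ P.d) (P.eta k) k g) k c =
      ∑ t ∈ range (P.L ^ k), ∑ p : TPlaq P k, g p * ∑ j ∈ Finset.range k, T t p j := by
    rw [lineSumIter_TkF_eq hd hk]
    simp_rw [eta_inv P k]
    rfl
  -- per scale: §3
  have hscale : ∀ j ∈ Finset.range k, ∑ p : TPlaq P k, ∑ t ∈ range (P.L ^ k), |T t p j| ≤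
      (2 * M ^ 2 * (MC * ((P.L : ℝ) ^ (k - j)) ^ (P.d - 2)) * (P.d : ℝ) ^ 2 * K1 * ((P.L : ℝ) ^ k / (P.L : ℝ) ^ j)) *
        (2 * (1 + 2 * (P.L : ℝ) ^ j / a₀) * Real.exp (3 * a₀ / 4) * S') := by
    intro j hj
    have hjk : j < k := Finset.mem_range.1 hj
    exact sum_line_plaq_term_le hd hk hjk ha hδ hδC (hH j (by omega) hjk) (hB j (by omega) hjk) (hC j hjk) x₀ μ
  -- per scale after the factor η: at most K₀ (here d = 2 is used)
  have hscale' : ∀ j ∈ Finset.range k, P.eta k * ∑ p : TPlaq P k, ∑ t ∈ range (P.L ^ k), |T t p j| ≤ K₀ := by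
    intro j hj
    have hjk : j < k := Finset.mem_range.1 hj
    have hLj : 0 < (P.L : ℝ) ^ j := cast_pow_L_pos' j
    have hLj1 : 1 ≤ (P.L : ℝ) ^ j := one_le_pow₀ (by exact_mod_cast P.L_pos)
    have hd0 : P.d - 2 = 0 := by omega
    have h := mul_le_mul_of_nonneg_left (hscale j hj) (eta_pos P k).le
    refine h.trans ?_
    rw [hd0, pow_zero, mul_one, hηk, hK₀]
    -- η·(L^k/L^j)·(1 + 2L^j/a₀) = (L^j)⁻¹ + 2/a₀ ≤ 1 + 2/a₀
    have hkey : ((P.L : ℝ) ^ k)⁻¹ * ((P.L : ℝ) ^ k / (P.L : ℝ) ^ j) * (2 * (1 + 2 * (P.L : ℝ) ^ j / a₀)) ≤ 2 * (1 + 2 / a₀) := by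
      have hLkne : (P.L : ℝ) ^ k ≠ 0 := hLk.ne'
      have hLjne : (P.L : ℝ) ^ j ≠ 0 := hLj.ne'
      have ha₀ne : a₀ ≠ 0 := ha₀p.ne'
      have e : ((P.L : ℝ) ^ k)⁻¹ * ((P.L : ℝ) ^ k / (P.L : ℝ) ^ j) * (2 * (1 + 2 * (P.L : ℝ) ^ j / a₀)) =
          2 * (((P.L : ℝ) ^ j)⁻¹ + 2 / a₀) := by
        field_simp
      rw [e]
      have : ((P.L : ℝ) ^ j)⁻¹ ≤ 1 := inv_le_one_of_one_le₀ hLj1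
      linarith
    have hfac : 0 ≤ 2 * M ^ 2 * MC * (P.d : ℝ) ^ 2 * K1 * (Real.exp (3 * a₀ / 4) * S') := by positivity
    calc ((P.L : ℝ) ^ k)⁻¹ * ((2 * M ^ 2 * MC * (P.d : ℝ) ^ 2 * K1 * ((P.L : ℝ) ^ k / (P.L : ℝ) ^ j)) *
          (2 * (1 + 2 * (P.L : ℝ) ^ j / a₀) * Real.exp (3 * a₀ / 4) * S'))
        = (2 * M ^ 2 * MC * (P.d : ℝ) ^ 2 * K1 * (Real.exp (3 * a₀ / 4) * S')) *
            (((P.L : ℝ) ^ k)⁻¹ * ((P.L : ℝ) ^ k / (P.L : ℝ) ^ j) * (2 * (1 + 2 * (P.L : ℝ) ^ j / a₀))) := by ring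
      _ ≤ (2 * M ^ 2 * MC * (P.d : ℝ) ^ 2 * K1 * (Real.exp (3 * a₀ / 4) * S')) * (2 * (1 + 2 / a₀)) :=
          mul_le_mul_of_nonneg_left hkey hfac
      _ = _ := by ring
  -- assemble
  rw [hrepr]
  have h1 : |∑ t ∈ range (P.L ^ k), ∑ p : TPlaq P k, g p * ∑ j ∈ Finset.range k, T t p j| ≤
      C * ∑ j ∈ Finset.range k, ∑ p : TPlaq P k, ∑ t ∈ range (P.L ^ k), |T t p j| := by
    calc _ ≤ ∑ t ∈ range (P.L ^ k), ∑ p : TPlaq P k, C * ∑ j ∈ Finset.range k, |T t p j| := by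
          refine (Finset.abs_sum_le_sum_abs _ _).trans (Finset.sum_le_sum fun t _ =>
            (Finset.abs_sum_le_sum_abs _ _).trans (Finset.sum_le_sum fun p _ => ?_))
          rw [abs_mul]
          exact mul_le_mul (hg p) (Finset.abs_sum_le_sum_abs _ _) (abs_nonneg _) hC0
      _ = C * ∑ t ∈ range (P.L ^ k), ∑ p : TPlaq P k, ∑ j ∈ Finset.range k, |T t p j| := by
          rw [Finset.mul_sum]; refine Finset.sum_congr rfl fun t _ => by rw [Finset.mul_sum]
      _ = C * ∑ j ∈ Finset.range k, ∑ p : TPlaq P k, ∑ t ∈ range (P.L ^ k), |T t p j| := by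
          congr 1
          calc ∑ t ∈ range (P.L ^ k), ∑ p : TPlaq P k, ∑ j ∈ Finset.range k, |T t p j|
              = ∑ t ∈ range (P.L ^ k), ∑ j ∈ Finset.range k, ∑ p : TPlaq P k, |T t p j| :=
                Finset.sum_congr rfl fun t _ => Finset.sum_comm
            _ = ∑ j ∈ Finset.range k, ∑ t ∈ range (P.L ^ k), ∑ p : TPlaq P k, |T t p j| := Finset.sum_comm
            _ = ∑ j ∈ Finset.range k, ∑ p : TPlaq P k, ∑ t ∈ range (P.L ^ k), |T t p j| :=
                Finset.sum_congr rfl fun j _ => Finset.sum_comm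
  have h2 : P.eta k * (C * ∑ j ∈ Finset.range k, ∑ p : TPlaq P k, ∑ t ∈ range (P.L ^ k), |T t p j|) ≤ C * (K₀ * k) := by
    rw [mul_left_comm, Finset.mul_sum]
    refine mul_le_mul_of_nonneg_left ?_ hC0
    calc ∑ j ∈ Finset.range k, P.eta k * ∑ p : TPlaq P k, ∑ t ∈ range (P.L ^ k), |T t p j|
        ≤ ∑ j ∈ Finset.range k, K₀ := Finset.sum_le_sum hscale'
      _ = K₀ * k := by rw [Finset.sum_const, Finset.card_range, nsmul_eq_mul, mul_comm]
  calc P.eta k * |∑ t ∈ range (P.L ^ k), ∑ p : TPlaq P k, g p * ∑ j ∈ Finset.range k, T t p j|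
      ≤ P.eta k * (C * ∑ j ∈ Finset.range k, ∑ p : TPlaq P k, ∑ t ∈ range (P.L ^ k), |T t p j|) :=
        mul_le_mul_of_nonneg_left h1 (eta_pos P k).le
    _ ≤ C * (K₀ * k) := h2
    _ = K₀ * k * C := by ring

/-! ## §5  All tori of dimension two, hypothesis-free -/

/-- kernel: weakening a kernel bound to a larger prefactor and a smaller rate. [folklore] -/
private theorem weaken_bound {M₁ M₂ δ₁ δ₂ t v : ℝ} (hM : M₁ ≤ M₂) (hM₂ : 0 ≤ M₂) (hδ : δ₂ ≤ δ₁) (ht : 0 ≤ t)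
    (h : v ≤ M₁ * Real.exp (-(δ₁ * t))) : v ≤ M₂ * Real.exp (-(δ₂ * t)) :=
  h.trans ((mul_le_mul_of_nonneg_right hM (Real.exp_pos _).le).trans
    (mul_le_mul_of_nonneg_left (Real.exp_le_exp.2 (by nlinarith)) hM₂))

/-- kernel: `0 ≤ |x − y|`. [folklore] -/
private theorem distEU_nonneg' {j : ℕ} (x : TSite P 0) (y : TSite P j) : 0 ≤ distEU P j x y := by
  rw [distEU]; positivity

/-- **`K_T ≤ K₀·k` FOR ALL TWO-DIMENSIONAL TORI, HYPOTHESIS-FREE**: for every odd `L > 1` there is ONE `K₀ ≥ 0` such that on every torus of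
the series with `d = 2`, `P.L = L`, for every scale `k ≤ m + K`, every unit-lattice plaquette function `g` with `|g| ≤ C` and every unit bond `c`,
`η·|Σ_{b′⊂c}(T_kg)_{b′}| ≤ K₀·k·C` — §4 fed with the all-tori members of (7.2.2) (p16/p19: `exists_absH_le_allTori`, `exists_gradB_allTori`,
scale `0` by `abs_H_zero_le`) and the all-tori (7.2.3) (`ineq723_CE`).  p11's `SecClosedIdx.hT` thus holds on every two-dimensional torus
with `K_T := K₀·k` (linear in the number of scales; the numerically observed k-uniform constant is not claimed).
[cite: BalabanImbrieJaffe1985, (7.3.2) p.326] -/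
theorem exists_KT_linear_allTori {L : ℕ} (hL : Odd L ∧ 1 < L) :
    ∃ K₀ : ℝ, 0 ≤ K₀ ∧ ∀ (P : Params) (hPd : P.d = 2) (hPL : P.L = L) (hd : 2 ≤ P.d) (k : ℕ) (hk : k ≤ P.m + P.K)
      (g : TPlaq P k → ℝ) (C : ℝ), (∀ q, |g q| ≤ C) → ∀ c : PBond P (0 + k),
      P.eta k * |lineSumIter (TkF P hd ((P.eta k) ^ P.d) (P.eta k) k g) k c| ≤ K₀ * k * C := by
  obtain ⟨δH, MH, hδH, hMH, hHall⟩ := exists_absH_le_allTori (d := 2) (L := L) (by norm_num) hL one_pos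
  obtain ⟨δB, MB, hδB, hMB, hBall⟩ := exists_gradB_allTori (d := 2) (L := L) (by norm_num) hL one_pos
  obtain ⟨MC, δC, hMC, hδC, hCall⟩ := ineq723_CE 2 L le_rfl
  set δ : ℝ := min δH δB with hδdef
  set M : ℝ := max MH MB with hMdef
  have hδ : 0 < δ := lt_min hδH hδB
  have hM1 : 1 ≤ M := hMH.trans (le_max_left _ _)
  have hM0 : 0 ≤ M := zero_le_one.trans hM1
  set a₀ : ℝ := min δ δC / 2 with ha₀
  have ha₀p : 0 < a₀ := half_pos (lt_min hδ hδC)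
  set K1 : ℝ := Real.exp (a₀ / 2) * ((2 * (1 + (2 : ℝ) / a₀)) ^ 2) ^ 2 with hK1
  set S' : ℝ := (2 : ℝ) ^ 2 * (Real.exp (a₀ / 2 / 2) * (2 * (1 + (2 : ℝ) / (a₀ / 2))) ^ 2) with hS'
  set K₀ : ℝ := (2 * M ^ 2 * MC * (2 : ℝ) ^ 2 * K1) * (2 * (1 + 2 / a₀) * Real.exp (3 * a₀ / 4) * S') with hK₀
  refine ⟨K₀, by positivity, fun P hPd hPL hd k hk g C hg c => ?_⟩
  have hH : ∀ (j : ℕ) (hj : j ≤ P.m + P.K), j < k → ∀ (μ ν : Fin P.d) (x : TSite P 0) (y : TSite P j),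
      |(torusRep P j (deltaAData hj 1)).H (x, μ) (y, ν)| ≤ M * Real.exp (-(δ * distEU P j x y)) := by
    intro j hj _ μ ν x y
    rcases Nat.eq_zero_or_pos j with hj0 | hjpos
    · subst hj0
      exact abs_H_zero_le hj one_pos hM1 δ μ ν x y
    · exact weaken_bound (le_max_left _ _) hM0 (min_le_left _ _) (distEU_nonneg' x y) (hHall P hPd hPL j hjpos hj μ ν x y)
  have hB : ∀ (j : ℕ) (hj : j ≤ P.m + P.K), j < k → ∀ (μ ν : Fin P.d) (x : TSite P 0) (y : TSite P j),
      ‖fun lam : Fin P.d => (P.L : ℝ) ^ j *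
          ((torusRep P j (deltaAData hj 1)).H (x.shift lam, μ) (y, ν) - (torusRep P j (deltaAData hj 1)).H (x, μ) (y, ν))‖ ≤
        M * Real.exp (-(δ * distEU P j x y)) := by
    intro j hj _ μ ν x y
    exact weaken_bound (le_max_right _ _) hM0 (min_le_right _ _) (distEU_nonneg' x y) (hBall P hPd hPL j hj μ ν x y)
  have hC : ∀ j < k, ∀ b₁ b₂ : PBond P j, |⟪toEj P j (Pi.single b₁ 1),
      CE P ((P.eta j) ^ P.d) ((P.L : ℝ) ^ j) j (toEj P j (Pi.single b₂ 1))⟫| ≤ MC * Real.exp (-(δC * (supDist b₁.src b₂.src : ℝ))) :=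
    fun j hjk b₁ b₂ => hCall P hPd hPL j inferInstance (by omega) b₁ b₂
  have h := eta_abs_lineSumIter_TkF_le_two hd hPd hk one_pos hδ hδC hH hB hC g hg c
  simp only [hPd, Nat.cast_ofNat] at h ⊢
  simpa only [hK₀, hK1, hS', ha₀] using h

end

end Literature.MathematicalPhysics.QuantumFieldTheory.BalabanImbrieJaffe1984to88.BIJ85LineSumTkBound
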